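import Literature.Topology.FourManifolds.BasinCone
import Literature.Topology.FourManifolds.ClosedBall
import HarnessLib

/-!
# The basin setting: the diffeomorphism of the sphere of directions at the minimum

Topic `Literature/Topology/FourManifolds`; tenth file of the endgame of the Torelli half of
Griffiths' handlebody theorem.  Everything here is **proved**.

For `B : BasinSetting g ξ`: the reference radius `rad = r₀/2`, the map of directions
`BasinSetting.sphereMap χ hχ : 𝕊ⁿ → 𝕊ⁿ`, `u ↦ rad⁻¹ • coneFun χ (rad • u)` (the direction of the
trajectory into which the level conjugation carries the trajectory of direction `u`): the cone
map is the cone over it (`coneFun_smul_coe`), the map of directions of a left inverse inverts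
it, it is smooth for `χ` smooth, supported in a compact subset of `∂W ∩ basin` and preserving the
traces (`contMDiff_sphereMap`, via `ContMDiff.codRestrict_sphere`), and for a mutually inverse
pair `(χ, χ')` it is a diffeomorphism `BasinSetting.sphereDiffeo` of `𝕊ⁿ`.

## References

* J. Milnor, *Lectures on the h-cobordism theorem*, notes by L. Siebenmann and J. Sondow,
  Princeton Mathematical Notes (1965): Def. 3.1, proof of Thm. 3.4 (PDF pp. 11–13), Def. 3.9
  (PDF p. 16), Thm. 4.1 (PDF p. 22), proof of Thm. 5.4, Assertion 4 (PDF p. 29).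
  [MilnorHCobordism1965]
* J. Milnor, *Morse theory* (1963), Thm. 3.1 and proof of Thm. 4.1 (p. 25). [Milnor1963]
* H. B. Griffiths, *Automorphisms of a 3-dimensional handlebody*, Abh. Math. Sem. Univ. Hamburg
  26 (1964), §§3–6. [GriffithsHB1964Handlebody]
-/

open scoped Manifold ContDiff Topology
open Set Function Filter Metric

noncomputable section

namespace Literature.Topology.FourManifolds

open Cobordism FourManifolds.Flow

universe u

variable {n : ℕ} {W : Type u} [TopologicalSpace W] [T2Space W] [SecondCountableTopology W]
  [CompactSpace W] [ChartedSpace (EuclideanHalfSpace (n + 1)) W] [IsManifold (𝓡∂ (n + 1)) ∞ W]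

/-! ### The diffeomorphism of the sphere of directions at `p₀` -/

namespace BasinSetting

attribute [local instance] fact_finrank_euclideanSpace_succ

variable {g : W → ℝ} {ξ : Π x : W, TangentSpace (𝓡∂ (n + 1)) x} (B : BasinSetting g ξ)

/-- **The radius of the reference sphere**, `rad = r₀ / 2`. [folklore] -/
def rad : ℝ := B.r₀ / 2

/-- `0 < rad`. [folklore] -/
theorem rad_pos : 0 < B.rad := by unfold rad; linarith [B.r₀_pos]

/-- `rad < r₀`. [folklore] -/
theorem rad_lt_r₀ : B.rad < B.r₀ := by unfold rad; linarith [B.r₀_pos]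

/-- `‖rad • u‖ = rad` for a unit vector `u`. [folklore] -/
theorem norm_rad_smul (u : Metric.sphere (0 : EuclideanSpace ℝ (Fin (n + 1))) 1) :
    ‖B.rad • (u : EuclideanSpace ℝ (Fin (n + 1)))‖ = B.rad := norm_smul_coe_sphere B.rad_pos.le u

variable [Nonempty (BoundaryManifold.boundaryData n W).carrier]

/-- The map of the sphere of directions, as a map into Euclidean space:
`u ↦ rad⁻¹ • coneFun χ (rad • u)`. [cite: GriffithsHB1964Handlebody, §§3–6] -/
def sphereMapFun (χ : (𝓡∂ (n + 1)).boundary W → (𝓡∂ (n + 1)).boundary W)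
    (u : Metric.sphere (0 : EuclideanSpace ℝ (Fin (n + 1))) 1) : EuclideanSpace ℝ (Fin (n + 1)) :=
  B.rad⁻¹ • B.coneFun χ (B.rad • (u : EuclideanSpace ℝ (Fin (n + 1))))

/-- Unfolding `sphereMapFun`. [folklore] -/
theorem sphereMapFun_apply (χ : (𝓡∂ (n + 1)).boundary W → (𝓡∂ (n + 1)).boundary W)
    (u : Metric.sphere (0 : EuclideanSpace ℝ (Fin (n + 1))) 1) :
    B.sphereMapFun χ u = B.rad⁻¹ • B.coneFun χ (B.rad • (u : EuclideanSpace ℝ (Fin (n + 1)))) := rfl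

variable {B}
variable {χ χ' : (𝓡∂ (n + 1)).boundary W → (𝓡∂ (n + 1)).boundary W}

/-- The map of directions takes unit values (the cone map preserves norms). [folklore] -/
theorem sphereMapFun_mem (hχ : ∀ y, χ y ∈ B.traces ↔ y ∈ B.traces)
    (u : Metric.sphere (0 : EuclideanSpace ℝ (Fin (n + 1))) 1) :
    B.sphereMapFun χ u ∈ Metric.sphere (0 : EuclideanSpace ℝ (Fin (n + 1))) 1 := by
  rw [mem_sphere_zero_iff_norm, sphereMapFun_apply, norm_smul, Real.norm_eq_abs, abs_of_pos (inv_pos.2 B.rad_pos),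
    norm_coneFun hχ (by rw [B.norm_rad_smul]; exact B.rad_lt_r₀), B.norm_rad_smul, inv_mul_cancel₀ B.rad_pos.ne']

variable (B)

/-- **The map of the sphere of directions at `p₀`** induced by `χ` (preserving the traces):
the direction of the trajectory into which the level conjugation carries the trajectory of the
given direction. [cite: GriffithsHB1964Handlebody, §§3–6] -/
def sphereMap (χ : (𝓡∂ (n + 1)).boundary W → (𝓡∂ (n + 1)).boundary W)
    (hχ : ∀ y, χ y ∈ B.traces ↔ y ∈ B.traces) :
    Metric.sphere (0 : EuclideanSpace ℝ (Fin (n + 1))) 1 → Metric.sphere (0 : EuclideanSpace ℝ (Fin (n + 1))) 1 :=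
  Set.codRestrict (B.sphereMapFun χ) _ (sphereMapFun_mem hχ)

/-- The map of directions in coordinates. [folklore] -/
@[simp] theorem coe_sphereMap (χ : (𝓡∂ (n + 1)).boundary W → (𝓡∂ (n + 1)).boundary W)
    (hχ : ∀ y, χ y ∈ B.traces ↔ y ∈ B.traces) (u : Metric.sphere (0 : EuclideanSpace ℝ (Fin (n + 1))) 1) :
    ((B.sphereMap χ hχ u : Metric.sphere (0 : EuclideanSpace ℝ (Fin (n + 1))) 1) : EuclideanSpace ℝ (Fin (n + 1))) =
      B.rad⁻¹ • B.coneFun χ (B.rad • (u : EuclideanSpace ℝ (Fin (n + 1)))) := rfl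

variable {B}

/-- **The cone map is the cone over the map of directions**: `coneFun χ (t • u) = t • sphereMap χ u`
for `0 < t ≤ rad`. [cite: GriffithsHB1964Handlebody, §§3–6] -/
theorem coneFun_smul_coe (hχ : ∀ y, χ y ∈ B.traces ↔ y ∈ B.traces) {t : ℝ} (ht0 : 0 < t) (ht : t ≤ B.rad)
    (u : Metric.sphere (0 : EuclideanSpace ℝ (Fin (n + 1))) 1) :
    B.coneFun χ (t • (u : EuclideanSpace ℝ (Fin (n + 1)))) =
      t • ((B.sphereMap χ hχ u : Metric.sphere (0 : EuclideanSpace ℝ (Fin (n + 1))) 1) : EuclideanSpace ℝ (Fin (n + 1))) := by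
  have hs : 0 < t / B.rad := div_pos ht0 B.rad_pos
  have hs1 : t / B.rad ≤ 1 := (div_le_one B.rad_pos).2 ht
  have h1 : t • (u : EuclideanSpace ℝ (Fin (n + 1))) = (t / B.rad) • (B.rad • (u : EuclideanSpace ℝ (Fin (n + 1)))) := by
    rw [smul_smul, div_mul_cancel₀ t B.rad_pos.ne']
  rw [h1, coneFun_smul hχ (by rw [B.norm_rad_smul]; exact B.rad_lt_r₀) hs hs1, coe_sphereMap, smul_smul,
    div_eq_mul_inv]

/-- **The map of directions of a left inverse inverts the map of directions.** [folklore] -/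
theorem sphereMap_sphereMap (h : LeftInverse χ' χ) (hχ : ∀ y, χ y ∈ B.traces ↔ y ∈ B.traces)
    (hχ' : ∀ y, χ' y ∈ B.traces ↔ y ∈ B.traces) (u : Metric.sphere (0 : EuclideanSpace ℝ (Fin (n + 1))) 1) :
    B.sphereMap χ' hχ' (B.sphereMap χ hχ u) = u := by
  apply Subtype.ext
  rw [coe_sphereMap, coe_sphereMap, smul_smul, mul_inv_cancel₀ B.rad_pos.ne', one_smul,
    coneFun_coneFun h hχ (by rw [B.norm_rad_smul]; exact B.rad_lt_r₀), smul_smul,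
    inv_mul_cancel₀ B.rad_pos.ne', one_smul]

/-- **The map of directions of a smooth `χ` (identity off a compact `K ⊆ ∂W ∩ basin`,
preserving the traces) is smooth.** [cite: GriffithsHB1964Handlebody, §§3–6] -/
theorem contMDiff_sphereMap (hχs : ContMDiff (𝓡 n) (𝓡 n) ∞ χ) (hχ : ∀ y, χ y ∈ B.traces ↔ y ∈ B.traces)
    {K : Set ((𝓡∂ (n + 1)).boundary W)} (hK : IsCompact K) (hKb : ∀ y ∈ K, (y : W) ∈ B.basin)
    (hχK : ∀ y, y ∉ K → χ y = y) : ContMDiff (𝓡 n) (𝓡 n) ∞ (B.sphereMap χ hχ) := by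
  have h1 : ContMDiff (𝓡 n) 𝓘(ℝ, EuclideanSpace ℝ (Fin (n + 1))) ∞ (B.sphereMapFun χ) := by
    intro u
    have hu0 : B.rad • (u : EuclideanSpace ℝ (Fin (n + 1))) ≠ 0 :=
      smul_ne_zero B.rad_pos.ne' (ne_zero_of_mem_unit_sphere u)
    have hcone := contMDiffAt_coneFun hχs hχ hK hKb hχK hu0 (by rw [B.norm_rad_smul]; exact B.rad_lt_r₀)
    have h2 : ContMDiffAt (𝓡 n) 𝓘(ℝ, EuclideanSpace ℝ (Fin (n + 1))) ∞
        (fun u : Metric.sphere (0 : EuclideanSpace ℝ (Fin (n + 1))) 1 => B.rad • (u : EuclideanSpace ℝ (Fin (n + 1)))) u :=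
      ((contDiff_const_smul B.rad).contMDiff.comp contMDiff_coe_sphere).contMDiffAt
    have h3 : ContMDiffAt (𝓡 n) 𝓘(ℝ, EuclideanSpace ℝ (Fin (n + 1))) ∞
        ((B.coneFun χ) ∘ fun u : Metric.sphere (0 : EuclideanSpace ℝ (Fin (n + 1))) 1 =>
          B.rad • (u : EuclideanSpace ℝ (Fin (n + 1)))) u := hcone.comp u h2
    have h4 : ContMDiffAt (𝓡 n) 𝓘(ℝ, EuclideanSpace ℝ (Fin (n + 1))) ∞
        ((fun w : EuclideanSpace ℝ (Fin (n + 1)) => B.rad⁻¹ • w) ∘ ((B.coneFun χ) ∘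
          fun u : Metric.sphere (0 : EuclideanSpace ℝ (Fin (n + 1))) 1 =>
            B.rad • (u : EuclideanSpace ℝ (Fin (n + 1))))) u :=
      (contDiff_const_smul B.rad⁻¹).contMDiff.contMDiffAt.comp u h3
    exact h4
  exact h1.codRestrict_sphere _

variable (B)

/-- **The diffeomorphism of the sphere of directions** induced by a diffeomorphism `χ` of `∂W`
with inverse `χ'`, both smooth, preserving the traces and the identity off a compact subset of
`∂W ∩ basin`. [cite: GriffithsHB1964Handlebody, §§3–6] -/
def sphereDiffeo (χ χ' : (𝓡∂ (n + 1)).boundary W → (𝓡∂ (n + 1)).boundary W)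
    (h : LeftInverse χ' χ) (h' : RightInverse χ' χ)
    (hχs : ContMDiff (𝓡 n) (𝓡 n) ∞ χ) (hχs' : ContMDiff (𝓡 n) (𝓡 n) ∞ χ')
    (hχ : ∀ y, χ y ∈ B.traces ↔ y ∈ B.traces) (hχ' : ∀ y, χ' y ∈ B.traces ↔ y ∈ B.traces)
    (K : Set ((𝓡∂ (n + 1)).boundary W)) (hK : IsCompact K) (hKb : ∀ y ∈ K, (y : W) ∈ B.basin)
    (hχK : ∀ y, y ∉ K → χ y = y) (hχK' : ∀ y, y ∉ K → χ' y = y) :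
    Metric.sphere (0 : EuclideanSpace ℝ (Fin (n + 1))) 1 ≃ₘ⟮𝓡 n, 𝓡 n⟯ Metric.sphere (0 : EuclideanSpace ℝ (Fin (n + 1))) 1 where
  toFun := B.sphereMap χ hχ
  invFun := B.sphereMap χ' hχ'
  left_inv := sphereMap_sphereMap h hχ hχ'
  right_inv := sphereMap_sphereMap h' hχ' hχ
  contMDiff_toFun := contMDiff_sphereMap hχs hχ hK hKb hχK
  contMDiff_invFun := contMDiff_sphereMap hχs' hχ' hK hKb hχK'

/-- The diffeomorphism of directions in coordinates. [folklore] -/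
theorem coe_sphereDiffeo (χ χ' : (𝓡∂ (n + 1)).boundary W → (𝓡∂ (n + 1)).boundary W)
    (h : LeftInverse χ' χ) (h' : RightInverse χ' χ)
    (hχs : ContMDiff (𝓡 n) (𝓡 n) ∞ χ) (hχs' : ContMDiff (𝓡 n) (𝓡 n) ∞ χ')
    (hχ : ∀ y, χ y ∈ B.traces ↔ y ∈ B.traces) (hχ' : ∀ y, χ' y ∈ B.traces ↔ y ∈ B.traces)
    (K : Set ((𝓡∂ (n + 1)).boundary W)) (hK : IsCompact K) (hKb : ∀ y ∈ K, (y : W) ∈ B.basin)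
    (hχK : ∀ y, y ∉ K → χ y = y) (hχK' : ∀ y, y ∉ K → χ' y = y)
    (u : Metric.sphere (0 : EuclideanSpace ℝ (Fin (n + 1))) 1) :
    B.sphereDiffeo χ χ' h h' hχs hχs' hχ hχ' K hK hKb hχK hχK' u = B.sphereMap χ hχ u := rfl

end BasinSetting

end Literature.Topology.FourManifolds
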